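import Literature.MathematicalPhysics.QuantumFieldTheory.Balaban1983to89.B9Cor36GpCubeEntriesAtV
import Literature.MathematicalPhysics.QuantumFieldTheory.Balaban1983to89.B9Cor36CinvCubeAtLocCfg
import Literature.MathematicalPhysics.QuantumFieldTheory.Balaban1983to89.B9Eq376ProjPieceDictY
import Literature.MathematicalPhysics.QuantumFieldTheory.Balaban1983to89.B9Eq376DerivDict
import Literature.MathematicalPhysics.QuantumFieldTheory.Balaban1983to89.B9Ineq349Hom
import Literature.MathematicalPhysics.QuantumFieldTheory.Balaban1983to89.B9Eq3105AtLetters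
import Literature.MathematicalPhysics.QuantumFieldTheory.Balaban1983to89.B9Cor36GCubeWindows

/-!
# `Balaban1983to89.B9Cor36DPDsCubeAtLocCfg` — [Balaban1985BackgroundPropagators] (3.49) p. 399 ∕ p. 403 «the operator P(U′U) satisfies the bounds (3.49)» FOR THE CUBE
# LETTER `𝒫_□ = G′_□Q′_□*(Q′_□G′_□²Q′_□*)⁻¹Q′_□G′_□` OF p. 409 AT THE LOCALISED FIELD `Ṽ_□ = e^{iηχ̃_□A}·1` OF THE (3.35) CUBE DATUM: the four entries `𝒫_□`,
# `D_Ṽ𝒫_□`, `𝒫_□D*_Ṽ`, `D_Ṽ𝒫_□D*_Ṽ ≺ K_P[1, (Lⁿη)⁻¹, (Lⁿη)⁻¹, (Lⁿη)⁻²]e^{−δ_P d}` over the cube sequence's blocks, uniformly in the member and the cover cube,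
# and — read in def-Y's bond letters — ★★★ THE BLOCK MAJORANT OF `conj b(DP_□D*(Ṽ_□))`, the displayed input `hP` of p33's DEFECT-R D2 `B9Cor36GCubeLocDefectCore`
# (sub-row G-B9-LETTERS, module M5.1b-G «Cor 3.5∕3.6 for the bond-sector cube letter G_□ = Δ_{a,□}⁻¹», item 2 «defect majorants», programme DEFECT-R, layer D2a)

T. Bałaban, *Propagators for lattice gauge theories in a background field*, Commun. Math. Phys. **99** (1985) 389–434
[`Balaban1985BackgroundPropagators`, "B9"]; [4] = T. Bałaban, *Propagators and renormalization transformations for lattice gauge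
theories. II*, Commun. Math. Phys. **96** (1984) 223–250 [`Balaban1984PropagatorsII`].

statement-level skeleton of published theorems with citation tags; proofs where landed; nothing here is a claim about the
Yang–Mills mass gap

THE PRINTED LOCUS (verbatim, held `paper:balaban1985-cmp99-background-propagators`, journal page = PDF page + 388; page owner r06).  p. 399: «These theorems imply all
the properties of the operator R, or DRD\*, we will need in the future. For the operator P = I − R we obtain, using again Lemma 2.1,
[|P(x,x′)|, |(DP)_μ(x,x′)|, |(PD\*)_ν(x,x′)|, |(DPD\*)_{μν}(x,x′)|] ≦ O(1)[1, (Lʲη)⁻¹, (Lʲη)⁻¹, (Lʲη)⁻²](L^{j′}η)^{−d}e^{−(1/2)δ₀d(y,y′)} … (3.49)»; p. 403 (the sentence before (3.68)):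
«These results imply that the operators R(U), P(U) = I − R(U) extend analytically to the domain (3.37) and satisfy the same bounds, e.g. the operator P(U′U)
satisfies the bounds (3.49)»; (3.25) p. 394 («R(U) = I − G′(U)Q′\*(U)(Q′(U)G′²(U)Q′\*(U))⁻¹Q′(U)G′(U)»); (3.26) p. 395 («Δ_a = Δ + DRD\* + Q\*aQ»); Cor. 3.6 p. 408
l. 1–10 («U′ = U^u = e^{iηA} with A satisfying the inequalities in (3.35) … U′ satisfies (3.37) for the sequence {Ω′_j} with U = 1 and α₁ = O(1)Mα₀»); p. 409
l. 1–5 («The operators constructed for this sequence, which we denote by G′_□(U), C_□(U) = (Q′(U)G′_□²(U)Q′\*(U))⁻¹, G_□(U), satisfy all the inequalities of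
Theorems 3.1–3.3 correspondingly»); (3.105) p. 414 (the letter `DP_□D*`); Thm 3.1 (3.42) p. 397, Thm 3.2 (3.48) p. 398, (3.19) p. 393, p. 398 (scale-transfer remark);
[4] Lemma 2.1 (2.60)–(2.61) p. 234, (2.51)–(2.55) p. 232.

WHY THIS FILE (cell `lit-balaban`; seat p38 gen 46; lead g33 RULING G-F8 SPLIT 2026-08-28T20:29:30Z «item 2 defect majorants → first free hand»).  p33's D2
(`B9Cor36GCubeLocDefectCore.hasMajorant_core_E ∕ _ET`, `hasMajorant_conj_locDefectBY ∕ TBY`) bounds the two defect letters of G-F2's local-inverse laws per cube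
MODULO one displayed block majorant `hP : conj b(DP_□D*(Ṽ)) ≺ K_P·ℓ_□(a)⁻²·e^{−a_Pδ₀d_□}` over `(toB6 (geoCK i □) Rr H, blkBK i □)`.  Every letter of
`DP_□D*(Ṽ_□) = D_Ṽ·(G′_□Q′_□*X̂⁻¹_□Q′_□G′_□)(Ṽ_□)·D*_Ṽ` is landed at the localised field: `conj b(η²G′_□(Ṽ_□))` with its COVARIANT (3.42)₂,₃ entries at `Ṽ_□`
(p33 `B9Cor36GpCubeEntriesAtV.gp_cube_entries_at_locCfg`), `conj b(η⁻⁴X̂⁻¹_□(Ṽ_□))` with (3.48) and the block-local two-space majorants of `Q′_□(Ṽ_□)`, `Q′_□*(Ṽ_□)`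
(p21 `B9Cor36CinvCubeAtLocCfg.cinv_cube_at_locCfg`); r06's typed (3.49) engine `B9Ineq349Hom.ineq349_hom` composes them ([4] Lemma 2.1 on the cube geometry:
p33's `exists_h261_geoCK`, `hST_geoCK`) once the directional entries are read as the two-space letters `D = conĵ(gradLin)`, `D* = conĵ(divLin)` (r06
`B9Eq376DerivDict`); p38 g43's dictionary `B9Eq376ProjPieceDictY` (`η²·η⁻⁴·η² = 1`, `r² = c_f²`, the carrier relabelling `FBondY × ι ≃ (Fin(d+1) × SiteY) × ι`)
carries the kernel VERBATIM to def-Y's `conj b(DP_□D*(Ṽ_□))` over `blkBK i □`.  Print: p. 399 «using again Lemma 2.1» + p. 403 «P(U′U) satisfies the bounds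
(3.49)», at the cube letters of p. 409 l. 1–5.

WHAT THIS FILE PROVES (THEOREMS; 0 `def`, 0 `def … : Prop`, 0 sorry; standard axioms).
* §1 `DPDsCubeY_eq_gradY_pWord_divY` (`DP_□D*(U) = D_U·(G′_□Q′_□*X̂⁻¹_□Q′_□G′_□)(U)·D*_U`, `R_□ = 1 − 𝒫_□`), `hasMajorant_conj_gradMdiv_of_relabel` (one `D·M·D*`
  word transports from r06's carrier to def-Y's with the same kernel — the one-word twin of g43's `hasMajorant_conj_gradMdiv_sub_of_relabel`).
* §2 ★★ `cor36_P349_cube_at_locCfg` — THE FOUR (3.49) ENTRIES AT THE CUBE AT `Ṽ_□`, uniformly in the member and the cover cube: there are `δ_P > 0`, `K_P ≥ 0`,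
  thresholds `M₀, T₀, N₀` and `a₁ > 0` (functions of `d, L, M₂, Σ‖b_j‖`) such that for every member above the thresholds, every cover cube, all `Rr, H` and every
  (3.35) cube datum `(A; Q, C, ξ, Λ)` (p21's readings) with `sRead C Λ ≤ a₁`, writing `𝒫̂ := conj b(η²G′_□(Ṽ_□)) ∘ conĵQ′_□*(Ṽ_□) ∘ conj b(η⁻⁴X̂⁻¹_□(Ṽ_□)) ∘ conĵQ′_□(Ṽ_□) ∘
  conj b(η²G′_□(Ṽ_□))`, `D := conĵ(gradLin (shiftY i) η⁻¹ (UboxY Ṽ_□))`, `D* := conĵ(divLin …)`:  `𝒫̂ ≺ K_P·e^{−δ_Pd}` (sites), `D∘𝒫̂ ≺ K_P(Lⁿη)⁻¹e^{−δ_Pd}`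
  (sites → bonds), `𝒫̂∘D* ≺ K_P(Lⁿη)⁻¹e^{−δ_Pd}` (bonds → sites), `D∘𝒫̂∘D* ≺ K_P(Lⁿη)⁻²e^{−δ_Pd}` (bonds), over `toB6 (geoCK i □) Rr H`.
* §3 ★★★ `hasMajorant_conj_DPDsCubeY_at_locCfg` — p33's `hP` VERBATIM at `parS := parSymY i`, `V := Ṽ_□ = locCfgY i □ η A`:
  `conj b((DP_□D*(Ṽ_□))^ℝ) ≺ K_P·((geoCK i □).len a ^ 2)⁻¹·e^{−δ_P·d(a,y)}` over `(toB6 (geoCK i □) Rr H, blkBK i □)` (rate in the form `δ_P = a_P·δ₀` for any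
  `δ₀ > 0` the consumer names: `a_P := δ_P∕δ₀`).

HONEST SCOPE ∕ NOT CLAIMED.  Assembly of landed estimates by [4] Lemma 2.1 (r06's engine BY NAME); block-majorant (operator) form, not print's pointwise kernel form
with `(L^{j′}η)^{−d}`; the rate `δ_P` and `K_P` are existential (print: `½δ₀`, `O(1)` — «of course with different constants», p. 403); the (3.35) cube datum
(`Q ⊇ NearC(35S_j∕8 + 1)`, `‖A‖ ≤ Cξ⁻¹`, `‖η⁻¹∂A‖ ≤ Cξ⁻²`, `ξ ≤ 5S_jη`, `L^{n+1}η ≤ Λξ`), the smallness `sRead C Λ ≤ a₁` (print: «α₁ = O(1)Mα₀ sufficiently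
small») and the member thresholds are displayed hypotheses exactly as in p21's `cinv_cube_at_locCfg` (p33's extra binder «`U^u = e^{iηA}` on `Q`» is vestigial for
the `A`-only letter `Ṽ_□` and is fed with `u := 1`, `U := e^{iηA}` inside the proof); `[NormOneClass 𝔸]`; transporters of record `parSymY`.  WHICH class cube supplies the datum is not decided here.  The Hölder sentence after (3.49) is not typed.  Count-neutral; no summit ∕ sub-problem statement
is proved; nothing continuum ∕ OS ∕ mass-gap ∕ Clay; NOT a node discharge; YM mass gap NOT proved by any of this (Track A conditional rung).  No `sorry`, no
`axiom`, no `… : Prop` fact, no `instance`, no `notation`, no `def`.  NEW file; nothing landed is modified.  Cell `lit-balaban`, seat `lit-balaban-p38` gen 46,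
2026-08-28; `--supports stmt-QuantumFields-19200` as helper.  Net new unproved facts: 0.

RELATED IN THE TREE, NOT DUPLICATED (searched 2026-08-28: `rg 'HasMajorant.*DPDsCubeY|P349_cube|DPDsCube.*locCfg'` over `Literature/` = ∅; the 15 importers of
`DPDsCubeY` use the letter inside (3.105) words only): r06 `B9Ineq349Hom.ineq349_hom` (the engine), `B9Eq376DerivDict` (directional ↔ two-space letters),
`B9Thm34RFinal` (the member-level precedent of the same four entries for `P(U′U)`), p33 `B9Cor36GpCubeEntriesAtV.gp_cube_entries_at_locCfg`, p21
`B9Cor36CinvCubeAtLocCfg.cinv_cube_at_locCfg`, p38 g43 `B9Eq376ProjPieceDictY` (dictionary) ∕ `B9Cor35POneAtCubeLetters` (the (3.77) DIFFERENCE word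
`D_Ṽ𝒫_□(Ṽ)D*_Ṽ − D₁𝒫_□(1)D*₁` — a different quantity), p33 `B9CubeGeometryInputs`, `B9Cor36GCubeWindows.sRead` — all USED BY NAME.
-/

noncomputable section

namespace Literature.MathematicalPhysics.QuantumFieldTheory.Balaban1983to89.B9Cor36DPDsCubeAtLocCfg

open B4PartitionUnity22 (thetaProf D1)
open B6RandomWalk (HasMajorant hasMajorant_mono Ineq261 c1_nonneg)
open B6RandomWalkHom (HasMajorantHom hasMajorantHom_mono)
open B9Thm34Ext (toB6)
open B9Ineq347 (ScaleTransfer)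
open B9Eq352DivFormLetters (conj)
open B9Eq352GradLetters (diffLetter)
open B9Eq376POneLetters (conjHom gradLin divLin)
open B9Eq376DerivDict (hasMajorantHom_gradLin hasMajorantHom_divLin)
open B9Ineq349Hom (ineq349_hom)
open B9Ineq368PPrime (kappa349)
open B9Ineq368PPrimeDs (kappa349_nonneg)
open B9Eq39Adjoint (covD fluct)
open B6KLevelCensusIndexV1 (KIdx kGeo)
open B6Cover236MultiLevelBlocks (cubes)
open B6GlobalChartV1 (PV boxEquiv)
open B9BackgroundsKLevelV1 (shiftsV1)
open B9Eq360DeltaPrimeAY (AfldY)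
open B9Eq360DeltaPrimeACubeY (blkCubeY)
open B9CubeLettersOpsL0 (GpCubeY)
open B9CubeLettersBondOpsL0 (BlkCubeY QpCubeY QpsCubeY XinvCubeY RCubeY)
open B9CubeGeometryInputs (geoCK geoCK_eta geoCK_dist_axioms geoCK_len_pos RM1 N1 exists_h261_geoCK hST_geoCK)
open B9Cor35GCubeInputsAtOne (blkBK)
open B9Cor35GpAtCubeLetters (hasMajorant_weaken)
open B9Cor36CubeCutoffs (SC NearC locCfgY)
open B9Cor36GpCubeExtAtV (GpVK)
open B9Cor36GpCubeEntriesAtV (gp_cube_entries_at_locCfg)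
open B9Cor36CinvCubeAtLocCfg (cinv_cube_at_locCfg)
open B9Eq359CubeKernelsAtOne (Cq Cq_nonneg)
open B9Eq376ProjPieceDictY (hasMajorant_of_relabel bondRelabelY conj_gradY_comp_divY_apply_eq pHatWord_eq_conj inv_eta_coe_eq)
open B9Eq3105AtLetters (DPDsCubeY)
open B9Cor36GCubeWindows (sRead)
open Node00 (SiteY CfgY GaugeY FBondY SiteParY toKT shiftY UboxY gaugeY gaugeY_apply parSymY gradY divY)
open Node00.OpsYNablaBridge (chartY)

variable {d ℓ : ℕ} {hd : 1 ≤ d + 1} {hL : Odd (ℓ + 1) ∧ 1 < ℓ + 1} {b₀ b₁ : ℝ}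
variable {𝔸 : Type} [NormedRing 𝔸] [NormedAlgebra ℂ 𝔸] [CompleteSpace 𝔸]
variable {ι : Type} [Fintype ι] (b : Module.Basis ι ℝ 𝔸)

/-! ## §1  `DP_□D* = D·𝒫_□·D*` with `𝒫_□ = G′_□Q′_□*X̂⁻¹_□Q′_□G′_□`; one `D·M·D*` word transports from r06's carrier to def-Y's -/

section Algebra

variable (i : KIdx d ℓ hd hL b₀ b₁) (c : ↥(cubes (toKT i).D.toDomains)) (par : SiteParY 𝔸 i)

/-- ★ `DP_□D*(U) = D_U·(G′_□Q′_□*(Q′_□G′_□²Q′_□*)⁻¹Q′_□G′_□)(U)·D*_U` — `P_□ = I − R_□` with (3.25) for the cube sequence.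
[cite: Balaban1985BackgroundPropagators, (3.25) p.394, (3.26) p.395, (3.105) p.414, p.409 l.1–5] -/
theorem DPDsCubeY_eq_gradY_pWord_divY (U : CfgY 𝔸 i) :
    DPDsCubeY i c par U =
      gradY i U ∘ₗ (GpCubeY i c par U ∘ₗ QpsCubeY i c par U ∘ₗ XinvCubeY i c par U ∘ₗ QpCubeY i c par U ∘ₗ GpCubeY i c par U) ∘ₗ divY i U := by
  rw [DPDsCubeY, RCubeY, sub_sub_cancel]

variable {g : B9.Geometry} [Fintype g.Site] {Rr : ℝ} {H : Prop}

/-- ★ **ONE `D·M·D*` WORD TRANSPORTS FROM r06's CARRIER TO def-Y's WITH THE SAME KERNEL** (`r² = c_f²`; the one-word twin of g43's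
`hasMajorant_conj_gradMdiv_sub_of_relabel`): a block majorant of `conĵ(gradLin r) ∘ conj b(M^ℝ) ∘ conĵ(divLin r)` over `q ↦ blk q.1.2` on `(Fin(d+1) × SiteY) × ι`
is a block majorant of `conj b((D_V M D*_V)^ℝ)` over `p ↦ blk(chart p₋)` on `FBondY × ι`.
[cite: Balaban1985BackgroundPropagators, (3.3) p.390, (3.8) p.392, (3.26) p.395; Balaban1984PropagatorsII, (2.51) p.232, dictionary] -/
theorem hasMajorant_conj_gradMdiv_of_relabel (blk : SiteY i → (toB6 g Rr H).Site) (V : CfgY 𝔸 i) (M : (SiteY i → 𝔸) →ₗ[ℂ] (SiteY i → 𝔸))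
    {r : ℝ} (hr : r ^ 2 = i.cf ^ 2) {K : g.Site → g.Site → ℝ}
    (h : HasMajorant (g := toB6 g Rr H) (fun q : (Fin (d + 1) × SiteY i) × ι => blk q.1.2)
      (conjHom b (gradLin (shiftY i) ((r : ℝ) : ℂ) (UboxY i V)) ∘ₗ conj b (M.restrictScalars ℝ) ∘ₗ conjHom b (divLin (shiftY i) ((r : ℝ) : ℂ) (UboxY i V))) K) :
    HasMajorant (g := toB6 g Rr H) (fun p : FBondY i × ι => blk (chartY i p.1.src))
      (conj b ((gradY i V ∘ₗ M ∘ₗ divY i V).restrictScalars ℝ)) K :=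
  hasMajorant_of_relabel (bondRelabelY i ι) (fun _ => rfl) (fun μ x => conj_gradY_comp_divY_apply_eq b i V M hr μ x) h

end Algebra

/-! ## §2  ★★ The four (3.49) entries of `𝒫_□(Ṽ_□)` at the cube (r06's typed engine fed with p33's `G′_□(Ṽ_□)` entries and p21's `X̂⁻¹_□ ∕ Q′_□ ∕ Q′_□*`) -/

section Entries

variable [NormOneClass 𝔸] [DecidableEq ι]

set_option maxHeartbeats 1600000 in
/-- ★★ **(3.49) FOR THE CUBE LETTER `𝒫_□ = I − R_□` AT THE LOCALISED FIELD `Ṽ_□`, ALL FOUR ENTRIES, UNIFORMLY IN THE MEMBER AND THE COVER CUBE** (p. 403 «the operator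
P(U′U) satisfies the bounds (3.49)» at the cube letters of p. 409): there are `δ_P > 0`, `K_P ≥ 0`, thresholds `M₀, T₀, N₀` and `a₁ > 0` such that for every member above
the thresholds, every cover cube `□`, all `Rr, H` and every (3.35) cube datum `(A; Q, C, ξ, Λ)` (p21's readings) with `sRead C Λ ≤ a₁`, with
`𝒫̂ := conj b(η²G′_□(Ṽ_□)) ∘ conĵQ′_□*(Ṽ_□) ∘ conj b(η⁻⁴X̂⁻¹_□(Ṽ_□)) ∘ conĵQ′_□(Ṽ_□) ∘ conj b(η²G′_□(Ṽ_□))`, `D := conĵ(gradLin (shiftY i) η⁻¹ (UboxY Ṽ_□))`, `D* := conĵ(divLin …)`: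
`𝒫̂ ≺ K_Pe^{−δ_Pd}` (sites), `D∘𝒫̂ ≺ K_P(Lⁿη)⁻¹e^{−δ_Pd}` (sites → bonds), `𝒫̂∘D* ≺ K_P(Lⁿη)⁻¹e^{−δ_Pd}` (bonds → sites), `D∘𝒫̂∘D* ≺ K_P(Lⁿη)⁻²e^{−δ_Pd}` (bonds).
[cite: Balaban1985BackgroundPropagators, (3.49) p.399, p.403 (before (3.68)), (3.25) p.394, Cor. 3.6 p.408 l.1–10, p.409 l.1–5, Thm 3.1 (3.42) p.397, Thm 3.2 (3.48) p.398, (3.19) p.393, p.398; Balaban1984PropagatorsII, Lemma 2.1 (2.60)–(2.61) p.234, (2.51)–(2.55) p.232] -/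
theorem cor36_P349_cube_at_locCfg (hℓ : 1 ≤ ℓ) (M₂ : ℝ) (hM₂ : 0 ≤ M₂) (hrepr : ∀ (v : 𝔸) (j : ι), |b.repr v j| ≤ M₂ * ‖v‖) :
    ∃ δP KP M₀ T₀ : ℝ, ∃ N₀ : ℕ, 0 < δP ∧ 0 ≤ KP ∧ ∃ a₁ : ℝ, 0 < a₁ ∧
    ∀ (i : KIdx d ℓ hd hL b₀ b₁) (c : ↥(cubes (toKT i).D.toDomains)) (Rr : ℝ) (H : Prop),
      M₀ ≤ ((ℓ : ℝ) + 1) * (toKT i).Mh → N₀ + 1 ≤ (toKT i).R * ((ℓ + 1) * (toKT i).Mh) → T₀ ≤ RM1 i →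
    ∀ (A : AfldY 𝔸 i) (Q : Set (Site (PV d ℓ i.m i.K hd hL) 0)) (C ξ Λ : ℝ),
      0 ≤ C → 0 < ξ → 1 ≤ Λ → ξ ≤ 5 * (SC i c : ℝ) * (kGeo i).eta → LatticeNorms.scaleLen ((ℓ : ℝ) + 1) (kGeo i).eta (c.1.1 + 1) ≤ Λ * ξ →
      (∀ x : Site (PV d ℓ i.m i.K hd hL) 0, NearC i c (35 * SC i c / 8 + 1) (boxEquiv i.hN x).1 → x ∈ Q) →
      (∀ κ, ∀ x ∈ Q, ‖A κ x‖ ≤ C * ξ⁻¹) →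
      (∀ μ ν, ∀ x ∈ Q, ‖(((kGeo i).eta : ℂ)⁻¹) • covD (shiftsV1 (PV d ℓ i.m i.K hd hL)) (fun _ _ => (1 : 𝔸ˣ)) μ (A ν) x‖ ≤ C * (ξ ^ 2)⁻¹) →
      sRead C Λ ≤ a₁ →
      HasMajorant (g := toB6 (geoCK i c) Rr H) (fun p : SiteY i × ι => blkCubeY i c p.1)
          (GpVK b i c (parSymY i) A ∘ₗ conjHom b ((QpsCubeY i c (parSymY i) (locCfgY i c (kGeo i).eta A)).restrictScalars ℝ) ∘ₗ
            conj b ((((kGeo i).eta ^ 4)⁻¹) • (XinvCubeY i c (parSymY i) (locCfgY i c (kGeo i).eta A)).restrictScalars ℝ) ∘ₗ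
            conjHom b ((QpCubeY i c (parSymY i) (locCfgY i c (kGeo i).eta A)).restrictScalars ℝ) ∘ₗ GpVK b i c (parSymY i) A)
          (fun a a' => KP * Real.exp (-(δP * (geoCK i c).dist a a'))) ∧
      HasMajorantHom (g := toB6 (geoCK i c) Rr H) (fun p : SiteY i × ι => blkCubeY i c p.1) (fun q : (Fin (d + 1) × SiteY i) × ι => blkCubeY i c q.1.2)
          (conjHom b (gradLin (shiftY i) (((kGeo i).eta : ℂ)⁻¹) (UboxY i (locCfgY i c (kGeo i).eta A))) ∘ₗ
            (GpVK b i c (parSymY i) A ∘ₗ conjHom b ((QpsCubeY i c (parSymY i) (locCfgY i c (kGeo i).eta A)).restrictScalars ℝ) ∘ₗ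
              conj b ((((kGeo i).eta ^ 4)⁻¹) • (XinvCubeY i c (parSymY i) (locCfgY i c (kGeo i).eta A)).restrictScalars ℝ) ∘ₗ
              conjHom b ((QpCubeY i c (parSymY i) (locCfgY i c (kGeo i).eta A)).restrictScalars ℝ) ∘ₗ GpVK b i c (parSymY i) A))
          (fun a a' => KP * ((geoCK i c).len a)⁻¹ * Real.exp (-(δP * (geoCK i c).dist a a'))) ∧
      HasMajorantHom (g := toB6 (geoCK i c) Rr H) (fun q : (Fin (d + 1) × SiteY i) × ι => blkCubeY i c q.1.2) (fun p : SiteY i × ι => blkCubeY i c p.1)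
          ((GpVK b i c (parSymY i) A ∘ₗ conjHom b ((QpsCubeY i c (parSymY i) (locCfgY i c (kGeo i).eta A)).restrictScalars ℝ) ∘ₗ
              conj b ((((kGeo i).eta ^ 4)⁻¹) • (XinvCubeY i c (parSymY i) (locCfgY i c (kGeo i).eta A)).restrictScalars ℝ) ∘ₗ
              conjHom b ((QpCubeY i c (parSymY i) (locCfgY i c (kGeo i).eta A)).restrictScalars ℝ) ∘ₗ GpVK b i c (parSymY i) A) ∘ₗ
            conjHom b (divLin (shiftY i) (((kGeo i).eta : ℂ)⁻¹) (UboxY i (locCfgY i c (kGeo i).eta A))))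
          (fun a a' => KP * ((geoCK i c).len a)⁻¹ * Real.exp (-(δP * (geoCK i c).dist a a'))) ∧
      HasMajorant (g := toB6 (geoCK i c) Rr H) (fun q : (Fin (d + 1) × SiteY i) × ι => blkCubeY i c q.1.2)
          (conjHom b (gradLin (shiftY i) (((kGeo i).eta : ℂ)⁻¹) (UboxY i (locCfgY i c (kGeo i).eta A))) ∘ₗ
            (GpVK b i c (parSymY i) A ∘ₗ conjHom b ((QpsCubeY i c (parSymY i) (locCfgY i c (kGeo i).eta A)).restrictScalars ℝ) ∘ₗ
              conj b ((((kGeo i).eta ^ 4)⁻¹) • (XinvCubeY i c (parSymY i) (locCfgY i c (kGeo i).eta A)).restrictScalars ℝ) ∘ₗ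
              conjHom b ((QpCubeY i c (parSymY i) (locCfgY i c (kGeo i).eta A)).restrictScalars ℝ) ∘ₗ GpVK b i c (parSymY i) A) ∘ₗ
            conjHom b (divLin (shiftY i) (((kGeo i).eta : ℂ)⁻¹) (UboxY i (locCfgY i c (kGeo i).eta A))))
          (fun a a' => KP * ((geoCK i c).len a ^ 2)⁻¹ * Real.exp (-(δP * (geoCK i c).dist a a'))) := by
  have hSb : 0 ≤ ∑ j, ‖b j‖ := Finset.sum_nonneg fun _ _ => norm_nonneg _
  have hMS : 0 ≤ M₂ * ∑ j, ‖b j‖ := mul_nonneg hM₂ hSb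
  have hCq := Cq_nonneg d
  have hL1 : (1 : ℝ) ≤ (ℓ : ℝ) + 1 := by linarith [(Nat.cast_nonneg ℓ : (0 : ℝ) ≤ ℓ)]
  -- the two cube packages at the localised field (p33 7b-C: `G′_□(Ṽ_□)` with covariant entries; p21 E2-5b-3: `X̂⁻¹_□`, `Q′_□`, `Q′_□*`)
  obtain ⟨δG, Bf, M₁, T₁, N₁, hδG, hBf, aG, haG, HG⟩ := gp_cube_entries_at_locCfg b d ℓ hℓ M₂ hM₂ hrepr
  obtain ⟨δC, BC, M₁', T₁', N₁', hδC, hBC, aC, haC, HC⟩ := cinv_cube_at_locCfg b d ℓ hℓ M₂ hM₂ hrepr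
  -- the common rate and [4] Lemma 2.1 on the cube geometry at that rate (exponents `α = β = 1/4`, output rate `δ/4`)
  have hδ : 0 < min δG δC := lt_min hδG hδC
  have hδG' : min δG δC ≤ δG := min_le_left _ _
  have hδC' : min δG δC ≤ δC := min_le_right _ _
  obtain ⟨dB, h261⟩ := exists_h261_geoCK d ℓ hδ
  -- the uniform constants
  have hκQ : 0 ≤ M₂ * (∑ j, ‖b j‖) * (1 + Cq d * (1 / 4)) := by positivity
  have hB₀ : 0 ≤ ((d : ℝ) + 1) * Bf := by positivity
  have hΛ4 : (1 : ℝ) ≤ ((ℓ : ℝ) + 1) ^ 4 := one_le_pow₀ hL1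
  have hKP : 0 ≤ kappa349 (M₂ * (∑ j, ‖b j‖) * (1 + Cq d * (1 / 4))) (((d : ℝ) + 1) * Bf) BC (((ℓ : ℝ) + 1) ^ 4)
      (B6.c1 dB (min δG δC) (1 / 4)) := kappa349_nonneg hBC.le
  refine ⟨min δG δC / 4, kappa349 (M₂ * (∑ j, ‖b j‖) * (1 + Cq d * (1 / 4))) (((d : ℝ) + 1) * Bf) BC (((ℓ : ℝ) + 1) ^ 4)
      (B6.c1 dB (min δG δC) (1 / 4)), max M₁ M₁', max (max T₁ T₁') (4 * Real.log ((ℓ : ℝ) + 1) / (9 / 5000 * min δG δC)),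
    max (max N₁ N₁') (N1 d ℓ (9 / 5000 * min δG δC)), by positivity, hKP, min (min aG aC) (1 / 4),
    lt_min (lt_min haG haC) (by norm_num), ?_⟩
  intro i c Rr H hM hN hT A Q C ξ Λ hC hξ hΛ hξS hΛξ hQ hA hdA hs
  -- `U^u = e^{iηA}` on `Q` is vestigial for the P-word (only `A` enters `Ṽ_□`): feed p33's binder with `u := 1`, `U := e^{iηA}`
  have hgA : ∀ (κ : Fin (d + 1)) (x : Site (PV d ℓ i.m i.K hd hL) 0), x ∈ Q → x.shift κ ∈ Q →
      gaugeY i (fun _ => (1 : 𝔸ˣ)) (fluct (kGeo i).eta A) κ x = fluct (kGeo i).eta A κ x := fun κ x _ _ => by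
    rw [gaugeY_apply, one_mul, inv_one, mul_one]
  -- thresholds
  have hM₁ : M₁ ≤ ((ℓ : ℝ) + 1) * (toKT i).Mh := (le_max_left _ _).trans hM
  have hM₁' : M₁' ≤ ((ℓ : ℝ) + 1) * (toKT i).Mh := (le_max_right _ _).trans hM
  have hT₁ : T₁ ≤ RM1 i := ((le_max_left _ _).trans (le_max_left _ _)).trans hT
  have hT₁' : T₁' ≤ RM1 i := ((le_max_right _ _).trans (le_max_left _ _)).trans hT
  have hTδ : 4 * Real.log ((ℓ : ℝ) + 1) / (9 / 5000 * min δG δC) ≤ RM1 i := (le_max_right _ _).trans hT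
  have hN₁ : N₁ + 1 ≤ (toKT i).R * ((ℓ + 1) * (toKT i).Mh) := le_trans (Nat.succ_le_succ ((le_max_left _ _).trans (le_max_left _ _))) hN
  have hN₁' : N₁' + 1 ≤ (toKT i).R * ((ℓ + 1) * (toKT i).Mh) := le_trans (Nat.succ_le_succ ((le_max_right _ _).trans (le_max_left _ _))) hN
  have hNδ : N1 d ℓ (9 / 5000 * min δG δC) + 1 ≤ (toKT i).R * ((ℓ + 1) * (toKT i).Mh) := le_trans (Nat.succ_le_succ (le_max_right _ _)) hN
  -- smallness in p33's ∕ p21's currency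
  have hs' : max C (C * (1 + D1 thetaProf)) * Λ ^ 2 ≤ min (min aG aC) (1 / 4) := hs
  have hαG : max C (C * (1 + D1 thetaProf)) * Λ ^ 2 ≤ aG := hs'.trans ((min_le_left _ _).trans (min_le_left _ _))
  have hαC : max C (C * (1 + D1 thetaProf)) * Λ ^ 2 ≤ aC := hs'.trans ((min_le_left _ _).trans (min_le_right _ _))
  have hα4 : max C (C * (1 + D1 thetaProf)) * Λ ^ 2 ≤ 1 / 4 := hs'.trans (min_le_right _ _)
  have hα0 : 0 ≤ max C (C * (1 + D1 thetaProf)) * Λ ^ 2 := mul_nonneg (le_max_of_le_left hC) (sq_nonneg _)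
  -- the letters at the localised field
  obtain ⟨-, hG, hDG, hGDs, -⟩ := HG i c Rr H hM₁ hN₁ hT₁ (fun _ => (1 : 𝔸ˣ)) (fluct (kGeo i).eta A) A Q C ξ Λ hC hξ hΛ hξS hΛξ hQ hgA hA hdA hαG hα4
  obtain ⟨⟨-, hCinv⟩, hQp, hQps⟩ := HC i c Rr H hM₁' hN₁' hT₁' A Q C ξ Λ hC hξ hΛ hξS hΛξ hQ hA hdA hαC hα4
  obtain ⟨hdnn, htri, -, -⟩ := geoCK_dist_axioms i c Rr H
  have hlen : ∀ y : (geoCK i c).Site, 0 < (geoCK i c).len y := geoCK_len_pos i c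
  -- (3.42)₁ for `conj b(η²G′_□(Ṽ_□))` at the common constant and rate
  have hBfB₀ : Bf ≤ ((d : ℝ) + 1) * Bf := by nlinarith [(Nat.cast_nonneg d : (0 : ℝ) ≤ d)]
  have hG' : HasMajorant (g := toB6 (geoCK i c) Rr H) (fun p : SiteY i × ι => blkCubeY i c p.1) (GpVK b i c (parSymY i) A)
      (fun a a' => ((d : ℝ) + 1) * Bf * (geoCK i c).len a ^ 2 * Real.exp (-(min δG δC * (geoCK i c).dist a a'))) :=
    hasMajorant_weaken i c Rr H (fun a => (geoCK i c).len a ^ 2) (fun a => sq_nonneg _) hBfB₀ hB₀ hδG' hG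
  -- (3.42)₂: the COVARIANT gradient at `Ṽ_□` composed with `G′_□(Ṽ_□)`, two-space typing (r06's dictionary)
  have hDG' : HasMajorantHom (g := toB6 (geoCK i c) Rr H) (fun p : SiteY i × ι => blkCubeY i c p.1)
      (fun q : (Fin (d + 1) × SiteY i) × ι => blkCubeY i c q.1.2)
      (conjHom b (gradLin (shiftY i) (((kGeo i).eta : ℂ)⁻¹) (UboxY i (locCfgY i c (kGeo i).eta A))) ∘ₗ GpVK b i c (parSymY i) A)
      (fun a a' => ((d : ℝ) + 1) * Bf * (geoCK i c).len a * Real.exp (-(min δG δC * (geoCK i c).dist a a'))) := by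
    have h := hasMajorantHom_gradLin (g := geoCK i c) (R := Rr) (H := H) b (shiftY i) (UboxY i (locCfgY i c (kGeo i).eta A)) (blkCubeY i c)
      (((kGeo i).eta : ℂ)⁻¹) (fun μ => hDG (Sum.inl μ))
    refine hasMajorantHom_mono (g := toB6 (geoCK i c) Rr H) _ _ h fun a a' => ?_
    have hw : 0 ≤ (geoCK i c).len a := (hlen a).le
    calc Bf * (geoCK i c).len a * Real.exp (-(δG * (geoCK i c).dist a a'))
        ≤ Bf * (geoCK i c).len a * Real.exp (-(min δG δC * (geoCK i c).dist a a')) :=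
          mul_le_mul_of_nonneg_left (Real.exp_le_exp.2 (by nlinarith [hdnn a a'])) (mul_nonneg hBf hw)
      _ ≤ ((d : ℝ) + 1) * Bf * (geoCK i c).len a * Real.exp (-(min δG δC * (geoCK i c).dist a a')) :=
          mul_le_mul_of_nonneg_right (mul_le_mul_of_nonneg_right hBfB₀ hw) (Real.exp_nonneg _)
  -- (3.42)₃: `G′_□(Ṽ_□)` composed with the COVARIANT divergence at `Ṽ_□` (the `d + 1` directions summed)
  have hGDs' : HasMajorantHom (g := toB6 (geoCK i c) Rr H) (fun q : (Fin (d + 1) × SiteY i) × ι => blkCubeY i c q.1.2)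
      (fun p : SiteY i × ι => blkCubeY i c p.1)
      (GpVK b i c (parSymY i) A ∘ₗ conjHom b (divLin (shiftY i) (((kGeo i).eta : ℂ)⁻¹) (UboxY i (locCfgY i c (kGeo i).eta A))))
      (fun a a' => ((d : ℝ) + 1) * Bf * (geoCK i c).len a * Real.exp (-(min δG δC * (geoCK i c).dist a a'))) := by
    have h := hasMajorantHom_divLin (g := geoCK i c) (R := Rr) (H := H) b (shiftY i) (UboxY i (locCfgY i c (kGeo i).eta A)) (blkCubeY i c)
      (((kGeo i).eta : ℂ)⁻¹) hGDs
    refine hasMajorantHom_mono (g := toB6 (geoCK i c) Rr H) _ _ h fun a a' => ?_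
    have hw : 0 ≤ (geoCK i c).len a := (hlen a).le
    rw [Fintype.card_fin]
    push_cast
    calc ((d : ℝ) + 1) * (Bf * (geoCK i c).len a * Real.exp (-(δG * (geoCK i c).dist a a')))
        = ((d : ℝ) + 1) * Bf * (geoCK i c).len a * Real.exp (-(δG * (geoCK i c).dist a a')) := by ring
      _ ≤ ((d : ℝ) + 1) * Bf * (geoCK i c).len a * Real.exp (-(min δG δC * (geoCK i c).dist a a')) :=
          mul_le_mul_of_nonneg_left (Real.exp_le_exp.2 (by nlinarith [hdnn a a'])) (mul_nonneg hB₀ hw)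
  -- (3.48) for `conj b(η⁻⁴X̂⁻¹_□(Ṽ_□))` (`(Lⁿη)^{−4} = ((Lⁿη)⁴)⁻¹`), rate weakened
  have hCinv' : HasMajorant (g := toB6 (geoCK i c) Rr H) (fun q : BlkCubeY i c × ι => q.1)
      (conj b ((((kGeo i).eta ^ 4)⁻¹) • (XinvCubeY i c (parSymY i) (locCfgY i c (kGeo i).eta A)).restrictScalars ℝ))
      (fun a a' => BC * ((geoCK i c).len a ^ 4)⁻¹ * Real.exp (-(min δG δC * (geoCK i c).dist a a'))) := by
    refine hasMajorant_mono (g := toB6 (geoCK i c) Rr H) _ hCinv fun a a' => ?_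
    have hp : (geoCK i c).len a ^ (-(4 : ℝ)) = ((geoCK i c).len a ^ 4)⁻¹ := by
      rw [Real.rpow_neg (hlen a).le, show (4 : ℝ) = ((4 : ℕ) : ℝ) by norm_num, Real.rpow_natCast]
    rw [hp]
    exact mul_le_mul_of_nonneg_left (Real.exp_le_exp.2 (by nlinarith [hdnn a a']))
      (mul_nonneg hBC.le (inv_nonneg.2 (pow_nonneg (hlen a).le 4)))
  -- the block-local letters `Q′_□(Ṽ_□)`, `Q′_□*(Ṽ_□)` at the uniform norm `κ_Q = M₂Σ‖b‖(1 + C_q∕4)` (`α₁ ≤ 1/4`)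
  have hκle : M₂ * (∑ j, ‖b j‖) * (1 + Cq d * (max C (C * (1 + D1 thetaProf)) * Λ ^ 2)) ≤ M₂ * (∑ j, ‖b j‖) * (1 + Cq d * (1 / 4)) :=
    mul_le_mul_of_nonneg_left (by nlinarith [mul_le_mul_of_nonneg_left hα4 hCq]) hMS
  have hQp' : HasMajorantHom (g := toB6 (geoCK i c) Rr H) (fun p : SiteY i × ι => blkCubeY i c p.1) (fun q : BlkCubeY i c × ι => q.1)
      (conjHom b ((QpCubeY i c (parSymY i) (locCfgY i c (kGeo i).eta A)).restrictScalars ℝ))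
      (fun a a' : BlkCubeY i c => if a = a' then M₂ * (∑ j, ‖b j‖) * (1 + Cq d * (1 / 4)) else 0) :=
    hasMajorantHom_mono (g := toB6 (geoCK i c) Rr H) _ _ hQp fun a a' => by split_ifs <;> [exact hκle; exact le_rfl]
  have hQps' : HasMajorantHom (g := toB6 (geoCK i c) Rr H) (fun q : BlkCubeY i c × ι => q.1) (fun p : SiteY i × ι => blkCubeY i c p.1)
      (conjHom b ((QpsCubeY i c (parSymY i) (locCfgY i c (kGeo i).eta A)).restrictScalars ℝ))
      (fun a a' : BlkCubeY i c => if a = a' then M₂ * (∑ j, ‖b j‖) * (1 + Cq d * (1 / 4)) else 0) :=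
    hasMajorantHom_mono (g := toB6 (geoCK i c) Rr H) _ _ hQps fun a a' => by split_ifs <;> [exact hκle; exact le_rfl]
  -- [4] Lemma 2.1 (2.61) and the p. 398 scale transfers at the common rate on the cube geometry
  have h261' : Ineq261 dB (toB6 (geoCK i c) Rr H) (min δG δC) (1 / 4) := h261 i c Rr H hNδ (1 / 4) (by norm_num) (by norm_num)
  obtain ⟨hT1, hT2, -, -, hT4, -⟩ := hST_geoCK i c hδ hTδ (1 / 4) (by norm_num)
  -- r06's typed (3.49) engine
  exact ineq349_hom (R := Rr) (H := H) (fun p : SiteY i × ι => blkCubeY i c p.1) (fun q : (Fin (d + 1) × SiteY i) × ι => blkCubeY i c q.1.2)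
    (fun q : BlkCubeY i c × ι => q.1) dB (min δG δC) (min δG δC) (1 / 4) (1 / 4) (min δG δC / 4) (((ℓ : ℝ) + 1) ^ 4)
    (M₂ * (∑ j, ‖b j‖) * (1 + Cq d * (1 / 4))) (((d : ℝ) + 1) * Bf) BC hκQ hB₀ hBC.le hΛ4 (by positivity) (by norm_num) (by norm_num) hδ.le
    (by linarith) hdnn htri hlen h261' hT1 hT2 hT4 hQp' hQps' hG' hDG' hGDs' hCinv'

end Entries

/-! ## §3  ★★★ The block majorant of `conj b(DP_□D*(Ṽ_□))` — the displayed `hP` of p33's DEFECT-R D2 -/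

section DefY

variable [NormOneClass 𝔸] [DecidableEq ι]

/-- ★★★ **THE P-WORD BLOCK MAJORANT `hP` OF p33's D2 `B9Cor36GCubeLocDefectCore.hasMajorant_core_E ∕ _ET`, SUPPLIED**: there are `δ_P > 0`, `K_P ≥ 0`, thresholds
`M₀, T₀, N₀` and `a₁ > 0` (functions of `d, L, M₂, Σ‖b_j‖`) such that for every member above the thresholds, every cover cube `□`, all `Rr, H` and every (3.35) cube datum
`(A; Q, C, ξ, Λ)` (p21's readings) with `sRead C Λ ≤ a₁`:
`conj b((DP_□D*(Ṽ_□))^ℝ) ≺ K_P·((geoCK i □).len a ^ 2)⁻¹·e^{−δ_P·d_□(a, y)}` over `(toB6 (geoCK i □) Rr H, blkBK i □)`, at `parS := parSymY i`, `Ṽ_□ = locCfgY i □ η A` —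
print's (3.49)₄ «|(DPD\*)_{μν}(x,x′)| ≦ O(1)(Lʲη)⁻²(L^{j′}η)^{−d}e^{−(1/2)δ₀d(y,y′)}» for the cube letter of p. 409 at the localised field (p. 403 «P(U′U) satisfies the bounds
(3.49)»), in [4]'s block-majorant form and def-Y's bond letters (§2's fourth entry through g43's dictionary).  Consumers quote the rate as `a_P·δ₀` with `a_P := δ_P∕δ₀`.
[cite: Balaban1985BackgroundPropagators, (3.49) p.399, p.403 (before (3.68)), (3.25) p.394, (3.26) p.395, (3.105) p.414, Cor. 3.6 p.408 l.1–10, p.409 l.1–5; Balaban1984PropagatorsII, Lemma 2.1 p.234, (2.51)–(2.55) p.232] -/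
theorem hasMajorant_conj_DPDsCubeY_at_locCfg (hℓ : 1 ≤ ℓ) (M₂ : ℝ) (hM₂ : 0 ≤ M₂) (hrepr : ∀ (v : 𝔸) (j : ι), |b.repr v j| ≤ M₂ * ‖v‖) :
    ∃ δP KP M₀ T₀ : ℝ, ∃ N₀ : ℕ, 0 < δP ∧ 0 ≤ KP ∧ ∃ a₁ : ℝ, 0 < a₁ ∧
    ∀ (i : KIdx d ℓ hd hL b₀ b₁) (c : ↥(cubes (toKT i).D.toDomains)) (Rr : ℝ) (H : Prop),
      M₀ ≤ ((ℓ : ℝ) + 1) * (toKT i).Mh → N₀ + 1 ≤ (toKT i).R * ((ℓ + 1) * (toKT i).Mh) → T₀ ≤ RM1 i →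
    ∀ (A : AfldY 𝔸 i) (Q : Set (Site (PV d ℓ i.m i.K hd hL) 0)) (C ξ Λ : ℝ),
      0 ≤ C → 0 < ξ → 1 ≤ Λ → ξ ≤ 5 * (SC i c : ℝ) * (kGeo i).eta → LatticeNorms.scaleLen ((ℓ : ℝ) + 1) (kGeo i).eta (c.1.1 + 1) ≤ Λ * ξ →
      (∀ x : Site (PV d ℓ i.m i.K hd hL) 0, NearC i c (35 * SC i c / 8 + 1) (boxEquiv i.hN x).1 → x ∈ Q) →
      (∀ κ, ∀ x ∈ Q, ‖A κ x‖ ≤ C * ξ⁻¹) →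
      (∀ μ ν, ∀ x ∈ Q, ‖(((kGeo i).eta : ℂ)⁻¹) • covD (shiftsV1 (PV d ℓ i.m i.K hd hL)) (fun _ _ => (1 : 𝔸ˣ)) μ (A ν) x‖ ≤ C * (ξ ^ 2)⁻¹) →
      sRead C Λ ≤ a₁ →
      HasMajorant (g := toB6 (geoCK i c) Rr H) (blkBK i c)
        (conj b ((DPDsCubeY i c (parSymY i) (locCfgY i c (kGeo i).eta A)).restrictScalars ℝ))
        (fun a y => KP * ((geoCK i c).len a ^ 2)⁻¹ * Real.exp (-(δP * (geoCK i c).dist a y))) := by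
  obtain ⟨δP, KP, M₀, T₀, N₀, hδP, hKP, a₁, ha₁, H4⟩ := cor36_P349_cube_at_locCfg b hℓ M₂ hM₂ hrepr
  refine ⟨δP, KP, M₀, T₀, N₀, hδP, hKP, a₁, ha₁, fun i c Rr H hM hN hT A Q C ξ Λ hC hξ hΛ hξS hΛξ hQ hA hdA hs => ?_⟩
  obtain ⟨-, -, -, h4⟩ := H4 i c Rr H hM hN hT A Q C ξ Λ hC hξ hΛ hξS hΛξ hQ hA hdA hs
  obtain ⟨hη, hsq⟩ := inv_eta_coe_eq i c
  have hη' : (((kGeo i).eta : ℂ))⁻¹ = ((|i.cf| : ℝ) : ℂ) := by rw [← geoCK_eta i c]; exact hη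
  rw [GpVK, pHatWord_eq_conj, hη'] at h4
  rw [DPDsCubeY_eq_gradY_pWord_divY]
  exact hasMajorant_conj_gradMdiv_of_relabel b i (g := geoCK i c) (Rr := Rr) (H := H) (blkCubeY i c) _ _ hsq h4

end DefY

end Literature.MathematicalPhysics.QuantumFieldTheory.Balaban1983to89.B9Cor36DPDsCubeAtLocCfg

end
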